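import Literature.Computability.Cryptography.LWEBinaryLHLBridge
import Literature.Computability.Cryptography.CoinBlockLaws
import Literature.Probability.Distributions.IndepProductLawDistance
import HarnessLib

/-!
# The leftover hash lemma for a binary MATRIX: `(H, HZ) ≈ (H, U)` for `Z ← {0,1}^{n×w}`

Topic `Computability/Cryptography`, sequel of `LeftoverHashUniversal.lean` (one binary column:
`Δ((H, Hz), (H, u)) ≤ ½ √(q^k / 2ⁿ)`, `LeftoverHash.distUnif_matrix_binVecs_le`, BLPRS 2013 Lemma 2.2)
and of the bridge `LWE.tvDist_uniformOfFinset_map_eq_distUnif` (`LWEBinaryLHLBridge.lean`). Here the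
same bound is extended to `w` binary columns SHARING the key `H` by the standard hybrid argument over
the columns:

  `Δ((H, HZ), (H, U)) ≤ w · ½ √(q^k / 2ⁿ)`,  `H ← ℤ_q^{k×n}`, `Z ← {0,1}^{n×w}`, `U ← ℤ_q^{k×w}`.

This is the "regularity" condition of the statistical instantiation of Micciancio–Peikert trapdoor
generation (MP12 §5.2: "`[Ā | ĀR]` is `δ`-uniform … for `δ ≤ (w/2)·√(qⁿ/2^m̄)` by a version of the
leftover hash lemma [AP09, §2.2.1]"), in the `{0,1}`-uniform instantiation of Alwen–Peikert /
Gentry–Peikert–Vaikuntanathan; `w = 1` is BLPRS Lemma 2.2. Everything is PROVED: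

* `binVecLaw q n` — the uniform law on `{0,1}ⁿ ⊆ ℤ_qⁿ` (the tree's flat source), and
  `uniformOfFintype_map_bitVecOf` — it is the image of `U({0,1}ⁿ)` under `b ↦ (bⱼ ? 1 : 0)`;
* `hashPairLaw`, `tvDist_hashPairLaw_uniform_le` — one column, `PMF` form of BLPRS Lemma 2.2;
* `matrixHashLaw q k n w` — the law of `(H, (Hz_c)_{c<w})`, `z_c` iid uniform binary — and the
  hybrid bound **`tvDist_matrixHashLaw_uniform_le`**: `Δ ≤ w · ½ √(q^k/2ⁿ)`;
* `mulBitMatrixLaw`, `tvDist_mulBitMatrixLaw_uniform_le` — the same for `(H, H·Z)` with `Z ← U({0,1}^{n×κ})` a uniform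
  Boolean MATRIX with an arbitrary finite column type `κ` (bound `|κ| · ½ √(q^k/2ⁿ)`), the form
  consumed by `Algebra/EuclideanLattices/GadgetTrapdoorUniformity.lean`.

Proof of the hybrid step (Goldreich 2001 §3.2.3): writing the `(w+1)`-column law as
`(law of (H, Hz₀)) ≫= K` with the kernel `K(H, y) = (H, y ∷ (Hz_c)_c)` and the uniform law as
`(uniform pair) ≫= K` up to the `w`-column error, kernel contraction (`PMF.tvDist_bind_left_le`)
charges `½ √(q^k/2ⁿ)` for the first column and the induction hypothesis for the rest.

## References

* D. Micciancio, C. Peikert, *Trapdoors for lattices: simpler, tighter, faster, smaller*,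
  EUROCRYPT 2012 (ePrint 2011/501), §5.2 "Statistical instantiation". [MicciancioPeikert2012]
* Z. Brakerski, A. Langlois, C. Peikert, O. Regev, D. Stehlé, *Classical hardness of learning with
  errors*, STOC 2013, Lemma 2.2. [BrakerskiEtAl2013]
* O. Goldreich, *Foundations of Cryptography I*, CUP 2001, §3.2.3 (hybrid arguments). [Goldreich2001]
-/

noncomputable section

open scoped ENNReal
open Matrix Finset Literature.Probability.Distributions

namespace Literature.Computability.Cryptography

namespace LeftoverHash

variable (q : ℕ)

/-! ### The uniform binary source as a `PMF` -/

/-- The uniform law on the flat source `{0,1}ⁿ ⊆ ℤ_qⁿ` (vectors with every coordinate `0` or `1`).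
[cite: BrakerskiEtAl2013, Lemma 2.2] -/
def binVecLaw [NeZero q] (n : ℕ) : PMF (Fin n → ZMod q) :=
  PMF.uniformOfFinset (Finset.univ.filter fun z : Fin n → ZMod q => ∀ j, z j = 0 ∨ z j = 1) binVecs_nonempty

/-- A Boolean vector read in `ℤ_q`: `(bⱼ ? 1 : 0)ⱼ`. [folklore] -/
def bitVecOf {n : ℕ} (b : Fin n → Bool) : Fin n → ZMod q := fun j => if b j then 1 else 0

/-- A Boolean matrix read in `ℤ_q`. [folklore] -/
def bitMatrix {α β : Type*} (B : Matrix α β Bool) : Matrix α β (ZMod q) := B.map fun b => if b then 1 else 0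

variable {q} {k n : ℕ}

/-- For `q ≥ 2`, `bitVecOf` is injective (`0 ≠ 1` in `ℤ_q`). [folklore] -/
theorem bitVecOf_injective (hq : 1 < q) : Function.Injective (bitVecOf q (n := n)) := by
  haveI : Fact (1 < q) := ⟨hq⟩
  intro b b' h
  funext j
  have hj := congrFun h j
  unfold bitVecOf at hj
  cases hb : b j <;> cases hb' : b' j <;> simp_all

variable [NeZero q]

/-- `bitVecOf b` is a binary vector. [folklore] -/
theorem bitVecOf_mem (b : Fin n → Bool) :
    bitVecOf q b ∈ (Finset.univ.filter fun z : Fin n → ZMod q => ∀ j, z j = 0 ∨ z j = 1) := by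
  refine (mem_filter_univ (bitVecOf q b)).2 fun j => ?_
  unfold bitVecOf
  cases b j <;> simp

/-- For `q ≥ 2`, every binary vector is `bitVecOf` of exactly one Boolean vector. [folklore] -/
theorem card_filter_bitVecOf_eq (hq : 1 < q) {z : Fin n → ZMod q}
    (hz : z ∈ (Finset.univ.filter fun z : Fin n → ZMod q => ∀ j, z j = 0 ∨ z j = 1)) :
    (Finset.univ.filter fun b : Fin n → Bool => bitVecOf q b = z).card = 1 := by
  haveI : Fact (1 < q) := ⟨hq⟩
  have h01 : (0 : ZMod q) ≠ 1 := zero_ne_one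
  rw [Finset.card_eq_one]
  refine ⟨fun j => decide (z j = 1), ?_⟩
  ext b
  simp only [Finset.mem_filter, Finset.mem_univ, true_and, Finset.mem_singleton]
  constructor
  · intro h
    funext j
    have hj := congrFun h j
    simp only [bitVecOf] at hj
    cases hb : b j
    · rw [hb, if_neg Bool.false_ne_true] at hj
      rw [← hj]
      simp [h01]
    · rw [hb, if_pos rfl] at hj
      rw [← hj]
      simp
  · rintro rfl
    funext j
    rcases (mem_filter_univ _).1 hz j with h | h
    · simp [bitVecOf, h]
    · simp [bitVecOf, h]

/-- **The flat binary source is the image of the uniform Boolean cube**: for `q ≥ 2`,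
`U({0,1}ⁿ).map bitVecOf = binVecLaw q n`. [folklore] -/
theorem uniformOfFintype_map_bitVecOf (hq : 1 < q) :
    (PMF.uniformOfFintype (Fin n → Bool)).map (bitVecOf q) = binVecLaw q n := by
  classical
  refine PMF.ext fun z => ?_
  rw [PMF.map_uniformOfFintype_apply, binVecLaw, PMF.uniformOfFinset_apply, card_binVecs hq,
    Fintype.card_fun, Fintype.card_bool, Fintype.card_fin]
  by_cases hz : z ∈ (Finset.univ.filter fun z : Fin n → ZMod q => ∀ j, z j = 0 ∨ z j = 1)
  · rw [if_pos hz, card_filter_bitVecOf_eq hq hz]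
    simp
  · rw [if_neg hz]
    have h0 : (Finset.univ.filter fun b : Fin n → Bool => bitVecOf q b = z).card = 0 := by
      rw [Finset.card_eq_zero, Finset.filter_eq_empty_iff]
      intro b _ hb
      exact hz (hb ▸ bitVecOf_mem b)
    rw [h0]
    simp

/-! ### One column: BLPRS Lemma 2.2 in `PMF` form -/

variable (q k n) in
/-- The law of `(H, Hz)` for `H ← U(ℤ_q^{k×n})`, `z ← U({0,1}ⁿ)`. [cite: BrakerskiEtAl2013, Lemma 2.2] -/
def hashPairLaw : PMF (Matrix (Fin k) (Fin n) (ZMod q) × (Fin k → ZMod q)) :=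
  (PMF.uniformOfFintype (Matrix (Fin k) (Fin n) (ZMod q))).bind fun H => (binVecLaw q n).map fun z => (H, H *ᵥ z)

/-- `hashPairLaw` is the keyed push-forward of the flat source `ℤ_q^{k×n} × {0,1}ⁿ` (the shape of
`LeftoverHash.distUnif_matrix_binVecs_le`). [cite: BrakerskiEtAl2013, Lemma 2.2] -/
theorem hashPairLaw_eq_map_keyed :
    hashPairLaw q k n =
      (PMF.uniformOfFinset ((Finset.univ : Finset (Matrix (Fin k) (Fin n) (ZMod q))) ×ˢ
          (Finset.univ.filter fun z : Fin n → ZMod q => ∀ j, z j = 0 ∨ z j = 1))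
          (Finset.univ_nonempty.product binVecs_nonempty)).map
        (keyed fun (H : Matrix (Fin k) (Fin n) (ZMod q)) (z : Fin n → ZMod q) => H *ᵥ z) := by
  rw [LWE.uniformOfFinset_product _ _ Finset.univ_nonempty binVecs_nonempty,
    show PMF.uniformOfFinset (Finset.univ : Finset (Matrix (Fin k) (Fin n) (ZMod q))) Finset.univ_nonempty =
      PMF.uniformOfFintype _ from rfl,
    prodLaw, PMF.map_bind, hashPairLaw, binVecLaw]
  refine congrArg _ (funext fun H => ?_)
  rw [PMF.map_comp]
  rfl

/-- **One column** (`PMF` form of BLPRS Lemma 2.2 / the tree's `distUnif_matrix_binVecs_le`): for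
`q ≥ 2`, `Δ((H, Hz), U) ≤ ½ √(q^k / 2ⁿ)`. [cite: BrakerskiEtAl2013, Lemma 2.2] -/
theorem tvDist_hashPairLaw_uniform_le (hq : 1 < q) :
    (hashPairLaw q k n).tvDist (PMF.uniformOfFintype _) ≤ 2⁻¹ * Real.sqrt ((q : ℝ) ^ k / 2 ^ n) := by
  rw [hashPairLaw_eq_map_keyed, LWE.tvDist_uniformOfFinset_map_eq_distUnif]
  have h := distUnif_matrix_binVecs_le (k := k) (n := n) hq
  rw [Finset.univ_product_univ] at h
  exact h

/-! ### `w` columns sharing the key: the hybrid argument -/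

variable (q k n) in
/-- The law of `(H, (H z_c)_{c < w})` for `H ← U(ℤ_q^{k×n})` and iid `z_c ← U({0,1}ⁿ)`: the key `H`
together with the hashes of `w` independent binary columns (i.e. `(H, HZ)` for `Z ← {0,1}^{n×w}`,
columns listed as a `w`-tuple). [cite: MicciancioPeikert2012, §5.2 (statistical instantiation, regularity)] -/
def matrixHashLaw (w : ℕ) : PMF (Matrix (Fin k) (Fin n) (ZMod q) × (Fin w → Fin k → ZMod q)) :=
  (PMF.uniformOfFintype (Matrix (Fin k) (Fin n) (ZMod q))).bind fun H =>
    (indepLaw w fun _ => (binVecLaw q n).map fun z => H *ᵥ z).map (Prod.mk H)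

/-- The kernel of the hybrid step: given the key and a first column value, append the hashes of `w`
fresh binary columns. [cite: Goldreich2001, §3.2.3] -/
def consKernel (w : ℕ) (p : Matrix (Fin k) (Fin n) (ZMod q) × (Fin k → ZMod q)) :
    PMF (Matrix (Fin k) (Fin n) (ZMod q) × (Fin (w + 1) → Fin k → ZMod q)) :=
  (indepLaw w fun _ => (binVecLaw q n).map fun z => p.1 *ᵥ z).map fun v => (p.1, Fin.cons p.2 v)

/-- The kernel of the second hybrid step: prepend a fresh uniform column. [cite: Goldreich2001, §3.2.3] -/
def freshKernel (w : ℕ) (p : Matrix (Fin k) (Fin n) (ZMod q) × (Fin w → Fin k → ZMod q)) :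
    PMF (Matrix (Fin k) (Fin n) (ZMod q) × (Fin (w + 1) → Fin k → ZMod q)) :=
  (PMF.uniformOfFintype (Fin k → ZMod q)).map fun y => (p.1, Fin.cons y p.2)

/-- Hybrid identity 1: the `(w+1)`-column law is the one-column law followed by `consKernel`.
[cite: Goldreich2001, §3.2.3] -/
theorem matrixHashLaw_succ (w : ℕ) :
    matrixHashLaw q k n (w + 1) = (hashPairLaw q k n).bind (consKernel w) := by
  rw [matrixHashLaw, hashPairLaw, PMF.bind_bind]
  refine congrArg _ (funext fun H => ?_)
  rw [indepLaw_succ, PMF.map_bind, PMF.bind_map, PMF.bind_map]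
  refine congrArg _ (funext fun z => ?_)
  simp only [Function.comp_def, consKernel, PMF.map_comp]

/-- Hybrid identity 2: the uniform pair followed by `consKernel` is the `w`-column law followed by
`freshKernel`. [cite: Goldreich2001, §3.2.3] -/
theorem uniform_bind_consKernel (w : ℕ) :
    (PMF.uniformOfFintype (Matrix (Fin k) (Fin n) (ZMod q) × (Fin k → ZMod q))).bind (consKernel w) =
      (matrixHashLaw q k n w).bind (freshKernel w) := by
  rw [uniformOfFintype_prod_eq_bind, PMF.bind_bind, matrixHashLaw, PMF.bind_bind]
  refine congrArg _ (funext fun H => ?_)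
  rw [PMF.bind_map, PMF.bind_map]
  simp only [Function.comp_def, consKernel, freshKernel, LWE.map_eq_bind_pure']
  rw [PMF.bind_comm]

/-- Hybrid identity 3: the uniform `(w+1)`-column law is the uniform `w`-column law followed by
`freshKernel`. [cite: Goldreich2001, §3.2.3] -/
theorem uniform_succ_eq_bind_freshKernel (w : ℕ) :
    PMF.uniformOfFintype (Matrix (Fin k) (Fin n) (ZMod q) × (Fin (w + 1) → Fin k → ZMod q)) =
      (PMF.uniformOfFintype (Matrix (Fin k) (Fin n) (ZMod q) × (Fin w → Fin k → ZMod q))).bind (freshKernel w) := by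
  rw [uniformOfFintype_prod_eq_bind, uniformOfFintype_prod_eq_bind, PMF.bind_bind]
  refine congrArg _ (funext fun H => ?_)
  rw [PMF.bind_map, ← indepLaw_uniformOfFintype (w + 1), indepLaw_succ, ← indepLaw_uniformOfFintype w]
  simp only [Function.comp_def, freshKernel, LWE.map_eq_bind_pure', PMF.bind_bind, PMF.pure_bind]
  rw [PMF.bind_comm]

/-- **The leftover hash lemma for `w` binary columns sharing the key (hybrid argument)**: for `q ≥ 2`,
`Δ((H, (Hz_c)_{c<w}), U) ≤ w · ½ √(q^k / 2ⁿ)`. [cite: MicciancioPeikert2012, §5.2 (statistical instantiation: "δ ≤ (w/2)·√(qⁿ/2^m̄) by a version of the leftover hash lemma")] -/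
theorem tvDist_matrixHashLaw_uniform_le (hq : 1 < q) : ∀ w : ℕ,
    (matrixHashLaw q k n w).tvDist (PMF.uniformOfFintype _) ≤ w * (2⁻¹ * Real.sqrt ((q : ℝ) ^ k / 2 ^ n))
  | 0 => by
    -- both laws are the image of `U(H)` under `H ↦ (H, ())`
    have h : matrixHashLaw q k n 0 =
        PMF.uniformOfFintype (Matrix (Fin k) (Fin n) (ZMod q) × (Fin 0 → Fin k → ZMod q)) := by
      rw [matrixHashLaw, uniformOfFintype_prod_eq_bind]
      refine congrArg _ (funext fun H => ?_)
      rw [indepLaw_zero]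
      have hu : PMF.uniformOfFintype (Fin 0 → Fin k → ZMod q) = PMF.pure Fin.elim0 := by
        refine PMF.ext fun v => ?_
        rw [PMF.uniformOfFintype_apply, PMF.pure_apply, if_pos (Subsingleton.elim _ _)]
        simp
      rw [hu]
    rw [h, PMF.tvDist_self]
    simp
  | w + 1 => by
    have step1 : (matrixHashLaw q k n (w + 1)).tvDist
        ((PMF.uniformOfFintype (Matrix (Fin k) (Fin n) (ZMod q) × (Fin k → ZMod q))).bind (consKernel w)) ≤
        2⁻¹ * Real.sqrt ((q : ℝ) ^ k / 2 ^ n) := by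
      rw [matrixHashLaw_succ]
      exact (PMF.tvDist_bind_left_le _ _ _).trans (tvDist_hashPairLaw_uniform_le hq)
    have step2 : ((PMF.uniformOfFintype (Matrix (Fin k) (Fin n) (ZMod q) × (Fin k → ZMod q))).bind (consKernel w)).tvDist
        (PMF.uniformOfFintype _) ≤ w * (2⁻¹ * Real.sqrt ((q : ℝ) ^ k / 2 ^ n)) := by
      rw [uniform_bind_consKernel, uniform_succ_eq_bind_freshKernel]
      exact (PMF.tvDist_bind_left_le _ _ _).trans (tvDist_matrixHashLaw_uniform_le hq w)
    calc (matrixHashLaw q k n (w + 1)).tvDist (PMF.uniformOfFintype _)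
        ≤ _ + _ := PMF.tvDist_triangle_holds _ _ _
      _ ≤ 2⁻¹ * Real.sqrt ((q : ℝ) ^ k / 2 ^ n) + w * (2⁻¹ * Real.sqrt ((q : ℝ) ^ k / 2 ^ n)) :=
          add_le_add step1 step2
      _ = ((w + 1 : ℕ) : ℝ) * (2⁻¹ * Real.sqrt ((q : ℝ) ^ k / 2 ^ n)) := by push_cast; ring

/-! ### Matrix form with an arbitrary finite column type -/

section MatrixForm

variable {κ : Type}

omit [NeZero q] in
/-- Reindexing the `w`-tuple of columns as a matrix with columns `κ ≃ Fin w`. [folklore] -/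
def colsToMatrix {w : ℕ} (e : κ ≃ Fin w) (p : Matrix (Fin k) (Fin n) (ZMod q) × (Fin w → Fin k → ZMod q)) :
    Matrix (Fin k) (Fin n) (ZMod q) × Matrix (Fin k) κ (ZMod q) :=
  (p.1, Matrix.of fun i c => p.2 (e c) i)

omit [NeZero q] in
/-- `colsToMatrix e` is a bijection. [folklore] -/
theorem colsToMatrix_bijective {w : ℕ} (e : κ ≃ Fin w) : Function.Bijective (colsToMatrix (q := q) (k := k) (n := n) e) := by
  refine ⟨fun p p' h => ?_, fun m => ⟨(m.1, fun c i => m.2 i (e.symm c)), ?_⟩⟩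
  · simp only [colsToMatrix, Prod.mk.injEq] at h
    refine Prod.ext h.1 (funext fun c => funext fun i => ?_)
    have := congrFun (congrFun h.2 i) (e.symm c)
    simpa using this
  · obtain ⟨H, M⟩ := m
    simp only [colsToMatrix, Prod.mk.injEq, true_and]
    ext i c
    simp

variable [Fintype κ] [DecidableEq κ]

/-- The law of `(H, H · Z)` for `H ← U(ℤ_q^{k×n})` and a uniform Boolean matrix `Z ← U({0,1}^{n×κ})`
read in `ℤ_q`. [cite: MicciancioPeikert2012, §5.2 (Alg. 1, statistical instantiation)] -/
def mulBitMatrixLaw (q : ℕ) [NeZero q] (k n : ℕ) (κ : Type) [Fintype κ] [DecidableEq κ] :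
    PMF (Matrix (Fin k) (Fin n) (ZMod q) × Matrix (Fin k) κ (ZMod q)) :=
  (PMF.uniformOfFintype (Matrix (Fin k) (Fin n) (ZMod q))).bind fun H =>
    (PMF.uniformOfFintype (Matrix (Fin n) κ Bool)).map fun Z => (H, H * bitMatrix q Z)

/-- The Boolean-matrix law is the reindexed column law: `mulBitMatrixLaw = (matrixHashLaw w).map (colsToMatrix e)`.
[folklore] -/
theorem mulBitMatrixLaw_eq_map (hq : 1 < q) {w : ℕ} (e : κ ≃ Fin w) :
    mulBitMatrixLaw q k n κ = (matrixHashLaw q k n w).map (colsToMatrix e) := by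
  classical
  -- the uniform Boolean matrix, column by column through `e`, is `w` iid uniform Boolean columns
  have hZ : (PMF.uniformOfFintype (Matrix (Fin n) κ Bool)).map
      (fun Z : Matrix (Fin n) κ Bool => fun c : Fin w => bitVecOf q fun i => Z i (e.symm c)) =
      indepLaw w fun _ => binVecLaw q n := by
    have hsplit : (fun Z : Matrix (Fin n) κ Bool => fun c : Fin w => bitVecOf q fun i => Z i (e.symm c)) =
        (fun v : Fin w → Fin n → Bool => fun c => bitVecOf q (v c)) ∘
          (fun Z : Matrix (Fin n) κ Bool => fun c : Fin w => fun i => Z i (e.symm c)) := rfl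
    let ψ : Matrix (Fin n) κ Bool ≃ (Fin w → Fin n → Bool) :=
      { toFun := fun Z c i => Z i (e.symm c)
        invFun := fun v => Matrix.of fun i c' => v (e c') i
        left_inv := fun Z => by ext i c'; simp
        right_inv := fun v => by funext c i; simp }
    rw [hsplit, ← PMF.map_comp, show (fun Z : Matrix (Fin n) κ Bool => fun c : Fin w => fun i => Z i (e.symm c)) = ⇑ψ from rfl,
      PMF.uniformOfFintype_map_equiv ψ, ← indepLaw_uniformOfFintype w,
      indepLaw_map_pi w (fun _ => PMF.uniformOfFintype (Fin n → Bool)) (fun _ => bitVecOf q)]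
    simp_rw [uniformOfFintype_map_bitVecOf hq]
  rw [mulBitMatrixLaw, matrixHashLaw, PMF.map_bind]
  refine congrArg _ (funext fun H => ?_)
  rw [PMF.map_comp, ← indepLaw_map_pi w (fun _ => binVecLaw q n) (fun _ z => H *ᵥ z), ← hZ, PMF.map_comp,
    PMF.map_comp]
  refine congrArg (PMF.map · _) (funext fun Z => ?_)
  simp only [Function.comp_apply, colsToMatrix, Prod.mk.injEq, true_and]
  ext i c
  simp [Matrix.mul_apply, Matrix.mulVec, dotProduct, bitMatrix, bitVecOf]

/-- **Leftover hash lemma, Boolean-matrix form**: for `q ≥ 2`, `H ← U(ℤ_q^{k×n})` and an independent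
uniform `Z ← U({0,1}^{n×κ})`, `Δ((H, H·Z), U(ℤ_q^{k×n} × ℤ_q^{k×κ})) ≤ |κ| · ½ √(q^k / 2ⁿ)`
(MP12's regularity bound `δ ≤ (w/2)·√(qⁿ/2^m̄)` with `w = |κ|`, for the `{0,1}`-uniform trapdoor
distribution). [cite: MicciancioPeikert2012, §5.2 (statistical instantiation)] -/
theorem tvDist_mulBitMatrixLaw_uniform_le (hq : 1 < q) :
    (mulBitMatrixLaw q k n κ).tvDist (PMF.uniformOfFintype _) ≤
      Fintype.card κ * (2⁻¹ * Real.sqrt ((q : ℝ) ^ k / 2 ^ n)) := by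
  classical
  obtain ⟨e⟩ : Nonempty (κ ≃ Fin (Fintype.card κ)) := ⟨Fintype.equivFin κ⟩
  set φ : Matrix (Fin k) (Fin n) (ZMod q) × (Fin (Fintype.card κ) → Fin k → ZMod q) ≃
      Matrix (Fin k) (Fin n) (ZMod q) × Matrix (Fin k) κ (ZMod q) := Equiv.ofBijective _ (colsToMatrix_bijective e)
  rw [mulBitMatrixLaw_eq_map hq e, show colsToMatrix e = ⇑φ from rfl, ← PMF.uniformOfFintype_map_equiv φ]
  exact (PMF.tvDist_map_le_holds _ _ _).trans (tvDist_matrixHashLaw_uniform_le hq _)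

end MatrixForm

end LeftoverHash

end Literature.Computability.Cryptography

end
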